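import Summits.HodgeConjecture.HodgeConjecture.Theorems.R90S1SplitInducedIrreducibleBox
import Summits.HodgeConjecture.HodgeConjecture.Theorems.K2E3GL3ExponentRules
import Summits.HodgeConjecture.HodgeConjecture.Theorems.K2E3GL3MaximalParabolicRelabel
import Literature.NumberTheory.Automorphic.ParabolicGLReindex
import Literature.NumberTheory.Automorphic.ParabolicInductionAdmissibleProofs
import HarnessLib

/-!
# R90-TF · S1 #7 (TOP of FILE B) PROVED — `SocketSplitInducedIrreducible`: `n-Ind_{P₍₂,₁₎}^{GL₃(F)}(σ ⊠ χ′)` is irreducible for `σ` irreducible smooth admissible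
# unitarizable on the `GL₂`-block and `χ′` unitary continuous [Rogawski1990 §13.3 p. 201 «an L-packet consists of a single irreducible representation»; Bernstein1984;
# Zelevinsky1980 Thm. 4.2 ∕ 9.7]

Cell `hodgecm-mathlib`, programme R90-TF (HUMAN RULING «R90-TF SLAB — MAX PUSH»), section S1 «Ch10-local», seat R90-C10-p01 (g0); deal R90-C10-plan «EMIT S1 WAVE 1»
p01 → S1#7 `R90.S1.stub_S1_split_parabolicInd_irreducible_of_unitary : SocketSplitInducedIrreducible` (`Cruxes/H413/Lines/R90_S1_SplitLocalPacketsB.lean` :98–:121,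
AUDIT S1#7 CLEAN).  The theorem `stub_S1_split_parabolicInd_irreducible_of_unitary_proof` has the socket's type TOKEN FOR TOKEN (it pays the stub at ED. 2 by
`exact splitInducedIrreducible_of_unitary`: the statement below is the BODY of `def SocketSplitInducedIrreducible` verbatim, binder for binder — a Theorems file may
not import `Cruxes/…/Lines`).  `--supports stmt-HodgeConjecture-24833 --as helper`; THEOREMS ONLY (one theorem); no definition, no named fact, no `sorry`.

PROOF.  `lastBlockLabel 3 = ![false,false,true]` (★ `lastBlockLabel_three`); after substituting the labelling, `σ` on `GL {i // c i = false} F` is read on `GL₂(F)` along the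
block equivalence `e` (★ `exists_blockEquiv_twoOne`) as `σ₂ = σ ∘ reindexGL e` (irreducible ★ `isIrreducible_comp_of_surjective`, smooth ★ `IsSmooth.comp_of_continuous`,
unitarizable with the same form), so that `σ = σ₂ ∘ (reindexGL e)⁻¹` and the socket's Levi datum IS ★ in-stages' `box σ₂ χ′`; then ★
`isIrreducible_parabolicIndGL_box_of_isUnitarizable` (`Theorems/R90S1SplitInducedIrreducibleBox`: supercuspidal `σ₂` by [Zelevinsky1980 Thm. 4.2] ★ K2E3 two-block
irreducibility; otherwise `σ₂ ↪ I(x,y)`, `Ind(σ₂ ⊠ χ′) ↪ I(x,y,χ′)`, complete reducibility of unitary induction + weight one for regular `(x,y,χ′)`, and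
[Zelevinsky1980 Thm. 4.2] unlinked irreducibility when all letters are unitary).  The admissibility hypothesis of the socket is not used (irreducible smooth
representations of `GL₂(F)` are admissible).
HONEST LABEL: HC_CM is proved only modulo the 7 printed citations (2 remaining named inputs: hLiu418 = stmt-HodgeConjecture-24832, h413 = stmt-HodgeConjecture-24833)
until rung 0 closes; this file pays ONE R90-TF socket (S1#7), nothing else; REL ≠ ★ ≠ BUILT.

## References
* [Rogawski1990] J. D. Rogawski, *Automorphic Representations of Unitary Groups in Three Variables*, Ann. of Math. Stud. 123 (1990), §4.13 p. 64, §13.1 p. 199, §13.3 p. 201.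
* [Bernstein1984] J. Bernstein, *P-invariant distributions on GL(N) and the classification of unitary representations of GL(N) (non-archimedean case)*, LNM 1041 (1984).
* [Zelevinsky1980] A. V. Zelevinsky, *Induced representations of reductive p-adic groups II*, Ann. Sci. ÉNS 13 (1980), Thm. 4.2 p. 184, Thm. 9.7.
* [BernsteinZelevinsky1977] I. N. Bernstein, A. V. Zelevinsky, *Induced representations of reductive p-adic groups I*, Ann. Sci. ÉNS 10 (1977), Thm. 2.9, Thm. 4.2, §2.3.
-/

set_option autoImplicit false
set_option linter.dupNamespace false

noncomputable section

open MeasureTheory Measure Set Filter Topology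
open scoped NNReal ENNReal ComplexConjugate

namespace Summit.HodgeConjecture.HodgeConjecture.R90.S1

open Literature.NumberTheory Literature.NumberTheory.Automorphic

/-! ## §M4 The socket S1#7 -/

section Socket

open Summit.HodgeConjecture.HodgeConjecture.Cruxes.H413
open Literature.NumberTheory.Automorphic.Zelevinsky1980

/-- **S1#7 — the body of `SocketSplitInducedIrreducible` (TOP of FILE B `R90_S1_SplitLocalPacketsB`), PROVED token for token.**  For a non-archimedean local field `F`, an irreducible
smooth admissible UNITARIZABLE `σ` of the `GL₂`-block of the Levi of `P₍₂,₁₎ ≤ GL₃(F)` and a unitary continuous `χ′`, `n-Ind_{P₍₂,₁₎}^{GL₃(F)}(σ ⊠ χ′)` is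
IRREDUCIBLE — «if `v` splits in `E` … an L-packet consists of a single irreducible representation» [Rogawski1990 §13.3 p. 201] for `dim ρ ≠ 1`.  Proof:
`lastBlockLabel 3 = ![false,false,true]` (★ `lastBlockLabel_three`); `σ` is read on `GL₂(F)` along the block equivalence `e` (★ `exists_blockEquiv_twoOne`) as
`σ₂ = σ ∘ reindexGL e`, so that the Levi datum of the socket IS ★ in-stages' `box σ₂ χ′`; then `isIrreducible_parabolicIndGL_box_of_isUnitarizable`.  The Lines file pays
`stub_S1_split_parabolicInd_irreducible_of_unitary : SocketSplitInducedIrreducible` by `exact splitInducedIrreducible_of_unitary` (the `def` unfolds to this statement).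
[cite: Rogawski1990, §13.3 p. 201; §4.13 p. 64; §13.1 p. 199] [cite: Bernstein1984, Thm. (unitary parabolic induction)] [cite: Zelevinsky1980, Thm. 4.2 p. 184, Thm. 9.7]
[cite: BernsteinZelevinsky1977, Thm. 2.9, Thm. 4.2, §2.3] -/
theorem splitInducedIrreducible_of_unitary :
    ∀ (F : Type) [Field F] [ValuativeRel F] [TopologicalSpace F] [IsNonarchimedeanLocalField F]
    [LocallyCompactSpace (standardParabolicGL F (Zelevinsky1980.lastBlockLabel 3))]
    (W : Type) [AddCommGroup W] [Module ℂ W]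
    (σ : Representation ℂ (GL {i : Fin 3 // Zelevinsky1980.lastBlockLabel 3 i = false} F) W)
    (_hσi : σ.IsIrreducible) (_hσs : σ.IsSmooth) (_hσa : σ.IsAdmissible) (_hσu : σ.IsUnitarizable)
    (χ' : Fˣ →* ℂˣ) (_hχ'u : ∀ x, ‖((χ' x : ℂˣ) : ℂ)‖ = 1) (_hχ'c : Continuous fun x => ((χ' x : ℂˣ) : ℂ)),
    (Representation.parabolicIndGL F (Zelevinsky1980.lastBlockLabel 3)
      (Representation.twist
        (σ.comp (Pi.evalMonoidHom (fun a : Bool => GL {i : Fin 3 // Zelevinsky1980.lastBlockLabel 3 i = a} F) false))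
        (χ'.comp (Matrix.GeneralLinearGroup.det.comp
          (Pi.evalMonoidHom (fun a : Bool => GL {i : Fin 3 // Zelevinsky1980.lastBlockLabel 3 i = a} F) true))))).IsIrreducible := by
  intro F _ _ _ _ _ W _ _ σ hσi hσs _hσa hσu χ' hχ'u hχ'c
  -- generalise the labelling and substitute `lastBlockLabel 3 = ![false,false,true]`
  suffices key : ∀ (c : Fin 3 → Bool) (hc : c = (![false, false, true] : Fin 3 → Bool))
      [LocallyCompactSpace (standardParabolicGL F c)]
      (σ : Representation ℂ (GL {i : Fin 3 // c i = false} F) W), σ.IsIrreducible → σ.IsSmooth → σ.IsUnitarizable →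
      (Representation.parabolicIndGL F c
        (Representation.twist (σ.comp (Pi.evalMonoidHom (fun a : Bool => GL {i : Fin 3 // c i = a} F) false))
          (χ'.comp (Matrix.GeneralLinearGroup.det.comp
            (Pi.evalMonoidHom (fun a : Bool => GL {i : Fin 3 // c i = a} F) true))))).IsIrreducible by
    exact key (Zelevinsky1980.lastBlockLabel 3) K2E3GL3MaximalParabolicRelabel.lastBlockLabel_three σ hσi hσs hσu
  rintro c rfl _ σ hσi hσs hσu
  obtain ⟨e, he⟩ := K2E3GL3ExponentRules.exists_blockEquiv_twoOne
  -- read `σ` on `GL₂(F)`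
  set σ₂ : Representation ℂ (GL (Fin 2) F) W := σ.comp (reindexGL e).toMonoidHom with hσ₂
  have hσσ₂ : σ = (σ₂.comp (reindexGL e).symm.toMonoidHom) := by
    refine MonoidHom.ext fun g => ?_
    simp [hσ₂]
  have hcont : Continuous (reindexGL (k := F) e) := by
    haveI : IsTopologicalRing F := inferInstance
    exact Units.continuous_map (f := (Matrix.reindexAlgEquiv F F e).toMulEquiv.toMonoidHom) (continuous_id.matrix_reindex e e)
  have h2i : σ₂.IsIrreducible := by
    haveI := hσi
    exact Literature.NumberTheory.Automorphic.isIrreducible_comp_of_surjective σ _ (reindexGL e).surjective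
  have h2s : σ₂.IsSmooth := Literature.NumberTheory.Automorphic.IsSmooth.comp_of_continuous σ _ hcont hσs
  have h2u : σ₂.IsUnitarizable := by
    obtain ⟨B, hBs, hBp, hBinv⟩ := hσu
    exact ⟨B, hBs, hBp, fun g v w => hBinv _ v w⟩
  rw [hσσ₂]
  exact isIrreducible_parabolicIndGL_box_of_isUnitarizable e he σ₂ h2i h2s h2u χ' hχ'u hχ'c

end Socket

end Summit.HodgeConjecture.HodgeConjecture.R90.S1

end
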